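import Literature.NumberTheory.Automorphic.UnitaryGroupDualPairCarriers
import HarnessLib

/-!
# The `W`-member of the doubled unitary dual pair `(U(V), U(W ⊕ W⁻))` on the diagonal `V ⊗ W^Δ`: Siegel elements
# stabilise it, and conversely

Topic `NumberTheory/Automorphic`; namespace `Literature.NumberTheory.Automorphic.UnitaryGroup` (sequel of `UnitaryGroupDualPairCarriers`,
`UnitaryGroupSymplecticEmbedding`).  KERNEL only: proved theorems, no definition, no named fact.

Setting: the dual-pair carriers of the tree for a quadratic extension `E ∕ F` of number fields (`c`, `δ`, `d`), `V` with Gram matrix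
`J_V = T_V ⊗ 1` (`T_V ∈ Sym_N(F)`) and a `W`-SPACE OF RANK TWO with Gram matrix `J = T ⊗ 1`, `T ∈ Sym₂(F)` — in the application
`W ⊕ W⁻`, `T = T_W ⊕ (−T_W)`, the hyperbolic hermitian plane of the doubling method.  The rational points `w ∈ U(J)(F)` act on the
restriction of scalars `𝕎_𝔸 = 𝔸_F^{N × 2} × 𝔸_F^{N × 2}` of `(V ⊗ W)_𝔸` through `1 ⊗ w` (★ `adelicPairToSymplectic ∘ rationalPairToAdelic ∘
rationalInr`, explicit block formula ★ `adelicPairToSymplectic_rationalPairToAdelic_apply`).  The DIAGONAL `V ⊗ W^Δ` is the set of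
vectors whose two `W`-coordinates agree: `a (i, 0) = a (i, 1)`, `b (i, 0) = b (i, 1)`.

* §1 `one_kronecker_map`, `one_kronecker_mulVec` — `(1 ⊗ M) a (i, c) = Σ_{c′} M_{c c′} a (i, c′)`; `one_kronecker_mulVec_diag` — if the
  two ROW SUMS of `M ∈ M₂` agree (the Siegel condition `M₀₀ + M₀₁ = M₁₀ + M₁₁` = «`M` stabilises the line spanned by `(1, 1)`») then
  `1 ⊗ M` preserves diagonal vectors; `rowSum_eq_of_one_kronecker_mulVec_one` — conversely (test vector `a ≡ 1`, `N ≠ 0`);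
* §2 **`adelicPairToSymplectic_rationalInr_diag`**: for a RATIONAL `w ∈ U(J)(F)` with `w₀₀ + w₀₁ = w₁₀ + w₁₁`, `ι(1 ⊗ w)` maps the
  diagonal `V ⊗ W^Δ ⊂ 𝕎_𝔸` into itself; **`rowSum_eq_of_adelicPairToSymplectic_rationalInr_diag`**: conversely, if `N ≠ 0` and
  `ι(1 ⊗ w)` maps the diagonal into itself then `w₀₀ + w₀₁ = w₁₀ + w₁₁` — «`(1 × P_Δ)(F) = (1 × U(W ⊕ W⁻)(F)) ∩ Stab(V ⊗ W^Δ)`», the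
  `W`-side of [GelbartPiatetskishapiroRallis1987, Part A §2 p. 9: «the stabilizer of `V^d` … is `(G × G) ∩ P`»] read through the see-saw
  `(U(V), U(W ⊕ W⁻))`.

Consumer: the orbit stub `stub_SW3_orbit` of the E-2 child line `F0_E2SiegelWeilWeilRange` of the Hodge-CM cell `pub/hodgecm-mathlib` (crux `H413`):
with ★ `DoubledUnitary.existsUnique_isSiegelReindex_blockDiagFin_inv_mul_of_rank_one` (one `U(W)(F)`-orbit modulo `P_Δ(F)`) and the frame
identities of the `Weil1964` doubling files it yields the bijection `U(W)(F) ≃ IW ⧸ PW`.  Seat F0P4-p08, 2026-08-31.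

## References

* [GelbartPiatetskishapiroRallis1987] S. Gelbart, I. Piatetski-Shapiro, S. Rallis, LNM 1254 (1987), Part A §2 pp. 7–9.
* [HarrisKudlaSweet1996] M. Harris, S. S. Kudla, W. J. Sweet, J. Amer. Math. Soc. 9 (1996), §1 (1.2)–(1.3), (1.11).
-/

set_option autoImplicit false

noncomputable section

open Matrix
open scoped Kronecker
open NumberField

namespace Literature.NumberTheory.Automorphic

namespace UnitaryGroup

/-! ## §1 `1 ⊗ M` on vectors and the diagonal -/

section KroneckerOne

variable {A B : Type*} [CommRing A] [CommRing B] {ν : Type*} [Fintype ν] [DecidableEq ν] {κ : Type*} [Fintype κ] [DecidableEq κ]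

omit [Fintype ν] [Fintype κ] [DecidableEq κ] in
/-- `(1 ⊗ W).map f = 1 ⊗ (W.map f)` for an additive `f` (e.g. the coordinate maps `re`, `im` of `E = F ⊕ F δ`, or a ring map).
[cite: HarrisKudlaSweet1996, §1 (1.11)] -/
theorem one_kronecker_map {F' : Type*} [FunLike F' A B] [AddMonoidHomClass F' A B] (f : F') (W : Matrix κ κ A) :
    ((1 : Matrix ν ν A) ⊗ₖ W).map f = (1 : Matrix ν ν B) ⊗ₖ W.map f := by
  ext ⟨i, a⟩ ⟨j, b⟩
  simp only [Matrix.map_apply, Matrix.kroneckerMap_apply, Matrix.one_apply]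
  split_ifs <;> simp

omit [DecidableEq κ] in
/-- **`((1 ⊗ M) a) (i, c) = Σ_{c′} M_{c c′} a (i, c′)`**: `1 ⊗ M` acts on the `W`-index only. [cite: HarrisKudlaSweet1996, §1 (1.11)] -/
theorem one_kronecker_mulVec (M : Matrix κ κ A) (a : ν × κ → A) (p : ν × κ) :
    (((1 : Matrix ν ν A) ⊗ₖ M) *ᵥ a) p = ∑ c, M p.2 c * a (p.1, c) := by
  rw [Matrix.mulVec, dotProduct, Fintype.sum_prod_type]
  simp only [Matrix.kroneckerMap_apply, Matrix.one_apply, ite_mul, one_mul, zero_mul]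
  rw [Finset.sum_eq_single p.1]
  · simp
  · intro b _ hb
    simp [Ne.symm hb]
  · intro h
    exact absurd (Finset.mem_univ _) h

/-- **a Siegel `M` (equal row sums: `M` stabilises the line of `(1, 1)`) makes `1 ⊗ M` preserve DIAGONAL vectors**
(`a (i, 0) = a (i, 1)` for all `i`). [cite: GelbartPiatetskishapiroRallis1987, Part A §2 p. 9] -/
theorem one_kronecker_mulVec_diag {M : Matrix (Fin (1 + 1)) (Fin (1 + 1)) A} (hM : M 0 0 + M 0 1 = M 1 0 + M 1 1)
    {a : ν × Fin (1 + 1) → A} (ha : ∀ i, a (i, 0) = a (i, 1)) (i : ν) :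
    (((1 : Matrix ν ν A) ⊗ₖ M) *ᵥ a) (i, 0) = (((1 : Matrix ν ν A) ⊗ₖ M) *ᵥ a) (i, 1) := by
  rw [one_kronecker_mulVec, one_kronecker_mulVec, Fin.sum_univ_two, Fin.sum_univ_two]
  dsimp only
  rw [ha i, ← add_mul, ← add_mul, hM]

/-- conversely: if `1 ⊗ M` keeps the constant vector `1` diagonal at one index `i`, the row sums of `M` agree.
[cite: GelbartPiatetskishapiroRallis1987, Part A §2 p. 9] -/
theorem rowSum_eq_of_one_kronecker_mulVec_one {M : Matrix (Fin (1 + 1)) (Fin (1 + 1)) A} (i : ν)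
    (h : (((1 : Matrix ν ν A) ⊗ₖ M) *ᵥ (fun _ => (1 : A))) (i, 0) = (((1 : Matrix ν ν A) ⊗ₖ M) *ᵥ (fun _ => (1 : A))) (i, 1)) :
    M 0 0 + M 0 1 = M 1 0 + M 1 1 := by
  rw [one_kronecker_mulVec, one_kronecker_mulVec, Fin.sum_univ_two, Fin.sum_univ_two] at h
  simpa using h

end KroneckerOne

/-! ## §2 The rational `W`-member of the doubled pair on the diagonal `V ⊗ W^Δ` -/

section Rational

variable (F E : Type) [Field F] [NumberField F] [Field E] [NumberField E] [Algebra F E] [Algebra.IsQuadraticExtension F E]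
  (c : E ≃ₐ[F] E) {δ : E} (hcδ : c δ = -δ) (hδ : δ ≠ 0) {d : F} (hd : δ * δ = algebraMap F E d)
  (N : ℕ) {TV : Matrix (Fin N) (Fin N) F} {TW : Matrix (Fin (1 + 1)) (Fin (1 + 1)) F}
  (hV : TV.IsSymm) (hW : TW.IsSymm) {JV : Matrix (Fin N) (Fin N) E} {JW : Matrix (Fin (1 + 1)) (Fin (1 + 1)) E}
  (hJV : JV = TV.map (algebraMap F E)) (hJW : JW = TW.map (algebraMap F E))

/-- **SIEGEL ⇒ STABILISES THE DIAGONAL**: for a rational `w ∈ U(J)(F)` on the rank-two space `W` whose row sums agree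
(`w₀₀ + w₀₁ = w₁₀ + w₁₁`: `w` stabilises the line `E·(1,1) = W^Δ`), the symplectic automorphism `ι(1 ⊗ w)` of `𝕎_𝔸 = Res (V ⊗ W)_𝔸`
maps every diagonal vector (`a (i,0) = a (i,1)`, `b (i,0) = b (i,1)`) to a diagonal vector.
[cite: GelbartPiatetskishapiroRallis1987, Part A §2 p. 9; HarrisKudlaSweet1996, §1 (1.11)] -/
theorem adelicPairToSymplectic_rationalInr_diag (w : rational F E c (1 + 1) JW)
    (hw : ((w : GL (Fin (1 + 1)) E) : Matrix (Fin (1 + 1)) (Fin (1 + 1)) E) 0 0 + (w : GL (Fin (1 + 1)) E) 0 1 =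
      ((w : GL (Fin (1 + 1)) E) : Matrix (Fin (1 + 1)) (Fin (1 + 1)) E) 1 0 + (w : GL (Fin (1 + 1)) E) 1 1)
    (v : (Fin N × Fin (1 + 1) → AdeleRing (𝓞 F) F) × (Fin N × Fin (1 + 1) → AdeleRing (𝓞 F) F))
    (hv : (∀ i, v.1 (i, 0) = v.1 (i, 1)) ∧ ∀ i, v.2 (i, 0) = v.2 (i, 1)) :
    (∀ i, ((adelicPairToSymplectic F E c N (1 + 1) hcδ hδ hd hV hW hJV hJW
        (rationalPairToAdelic F E c N (1 + 1) JV JW (rationalInr F E c N (1 + 1) JV JW w))).1 v).1 (i, 0) =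
      ((adelicPairToSymplectic F E c N (1 + 1) hcδ hδ hd hV hW hJV hJW
        (rationalPairToAdelic F E c N (1 + 1) JV JW (rationalInr F E c N (1 + 1) JV JW w))).1 v).1 (i, 1)) ∧
    ∀ i, ((adelicPairToSymplectic F E c N (1 + 1) hcδ hδ hd hV hW hJV hJW
        (rationalPairToAdelic F E c N (1 + 1) JV JW (rationalInr F E c N (1 + 1) JV JW w))).1 v).2 (i, 0) =
      ((adelicPairToSymplectic F E c N (1 + 1) hcδ hδ hd hV hW hJV hJW
        (rationalPairToAdelic F E c N (1 + 1) JV JW (rationalInr F E c N (1 + 1) JV JW w))).1 v).2 (i, 1) := by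
  obtain ⟨a, b⟩ := v
  obtain ⟨ha, hb⟩ := hv
  set Ψ := (quadraticRatCoords E (not_mem_range_algebraMap_of_apply_eq_neg E c hcδ hδ)).toAddEquiv with hΨ
  have hcoe : (((rationalInr F E c N (1 + 1) JV JW w : rationalPair F E c N (1 + 1) JV JW) : GL (Fin N × Fin (1 + 1)) E) :
      Matrix (Fin N × Fin (1 + 1)) (Fin N × Fin (1 + 1)) E) =
      (1 : Matrix (Fin N) (Fin N) E) ⊗ₖ ((w : GL (Fin (1 + 1)) E) : Matrix (Fin (1 + 1)) (Fin (1 + 1)) E) := rfl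
  -- the real and imaginary parts of `1 ⊗ w` are `1 ⊗ re w`, `1 ⊗ im w`, and both are Siegel
  set W₁ : Matrix (Fin (1 + 1)) (Fin (1 + 1)) (AdeleRing (𝓞 F) F) :=
    (((w : GL (Fin (1 + 1)) E) : Matrix (Fin (1 + 1)) (Fin (1 + 1)) E).map (QuadraticCoordinates.re Ψ)).map
      (algebraMap F (AdeleRing (𝓞 F) F)) with hW₁
  set W₂ : Matrix (Fin (1 + 1)) (Fin (1 + 1)) (AdeleRing (𝓞 F) F) :=
    (((w : GL (Fin (1 + 1)) E) : Matrix (Fin (1 + 1)) (Fin (1 + 1)) E).map (QuadraticCoordinates.im Ψ)).map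
      (algebraMap F (AdeleRing (𝓞 F) F)) with hW₂
  have hre : ((((rationalInr F E c N (1 + 1) JV JW w : rationalPair F E c N (1 + 1) JV JW) :
      GL (Fin N × Fin (1 + 1)) E) : Matrix (Fin N × Fin (1 + 1)) (Fin N × Fin (1 + 1)) E).map
        (QuadraticCoordinates.re Ψ)).map (algebraMap F (AdeleRing (𝓞 F) F)) =
      (1 : Matrix (Fin N) (Fin N) (AdeleRing (𝓞 F) F)) ⊗ₖ W₁ := by
    rw [hcoe, one_kronecker_map, one_kronecker_map]
  have him : ((((rationalInr F E c N (1 + 1) JV JW w : rationalPair F E c N (1 + 1) JV JW) :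
      GL (Fin N × Fin (1 + 1)) E) : Matrix (Fin N × Fin (1 + 1)) (Fin N × Fin (1 + 1)) E).map
        (QuadraticCoordinates.im Ψ)).map (algebraMap F (AdeleRing (𝓞 F) F)) =
      (1 : Matrix (Fin N) (Fin N) (AdeleRing (𝓞 F) F)) ⊗ₖ W₂ := by
    rw [hcoe, one_kronecker_map, one_kronecker_map]
  have hW₁S : W₁ 0 0 + W₁ 0 1 = W₁ 1 0 + W₁ 1 1 := by
    simp only [hW₁, Matrix.map_apply, ← map_add, hw]
  have hW₂S : W₂ 0 0 + W₂ 0 1 = W₂ 1 0 + W₂ 1 1 := by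
    simp only [hW₂, Matrix.map_apply, ← map_add, hw]
  rw [adelicPairToSymplectic_rationalPairToAdelic_apply, ← hΨ, hre, him]
  refine ⟨fun i => ?_, fun i => ?_⟩
  · simp only [Pi.add_apply, Pi.smul_apply]
    rw [one_kronecker_mulVec_diag hW₁S ha i, one_kronecker_mulVec_diag hW₂S hb i]
  · simp only [Pi.add_apply]
    rw [one_kronecker_mulVec_diag hW₂S ha i, one_kronecker_mulVec_diag hW₁S hb i]

/-- **STABILISES THE DIAGONAL ⇒ SIEGEL** (`N ≠ 0`): if `ι(1 ⊗ w)` maps the diagonal test vector `(1, 0)` to a vector whose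
first component is diagonal at some index `i`, then `w₀₀ + w₀₁ = w₁₀ + w₁₁`. [cite: GelbartPiatetskishapiroRallis1987, Part A §2 p. 9] -/
theorem rowSum_eq_of_adelicPairToSymplectic_rationalInr_diag (w : rational F E c (1 + 1) JW) (i : Fin N)
    (h : ((adelicPairToSymplectic F E c N (1 + 1) hcδ hδ hd hV hW hJV hJW
        (rationalPairToAdelic F E c N (1 + 1) JV JW (rationalInr F E c N (1 + 1) JV JW w))).1
          ((fun _ => (1 : AdeleRing (𝓞 F) F)), 0)).1 (i, 0) =
      ((adelicPairToSymplectic F E c N (1 + 1) hcδ hδ hd hV hW hJV hJW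
        (rationalPairToAdelic F E c N (1 + 1) JV JW (rationalInr F E c N (1 + 1) JV JW w))).1
          ((fun _ => (1 : AdeleRing (𝓞 F) F)), 0)).1 (i, 1) ∧
      ((adelicPairToSymplectic F E c N (1 + 1) hcδ hδ hd hV hW hJV hJW
        (rationalPairToAdelic F E c N (1 + 1) JV JW (rationalInr F E c N (1 + 1) JV JW w))).1
          ((fun _ => (1 : AdeleRing (𝓞 F) F)), 0)).2 (i, 0) =
      ((adelicPairToSymplectic F E c N (1 + 1) hcδ hδ hd hV hW hJV hJW
        (rationalPairToAdelic F E c N (1 + 1) JV JW (rationalInr F E c N (1 + 1) JV JW w))).1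
          ((fun _ => (1 : AdeleRing (𝓞 F) F)), 0)).2 (i, 1)) :
    ((w : GL (Fin (1 + 1)) E) : Matrix (Fin (1 + 1)) (Fin (1 + 1)) E) 0 0 + (w : GL (Fin (1 + 1)) E) 0 1 =
      ((w : GL (Fin (1 + 1)) E) : Matrix (Fin (1 + 1)) (Fin (1 + 1)) E) 1 0 + (w : GL (Fin (1 + 1)) E) 1 1 := by
  have hq := isQuadraticCoordinates_rat E c hcδ hδ hd
  set Ψ := (quadraticRatCoords E (not_mem_range_algebraMap_of_apply_eq_neg E c hcδ hδ)).toAddEquiv with hΨ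
  have hcoe : (((rationalInr F E c N (1 + 1) JV JW w : rationalPair F E c N (1 + 1) JV JW) : GL (Fin N × Fin (1 + 1)) E) :
      Matrix (Fin N × Fin (1 + 1)) (Fin N × Fin (1 + 1)) E) =
      (1 : Matrix (Fin N) (Fin N) E) ⊗ₖ ((w : GL (Fin (1 + 1)) E) : Matrix (Fin (1 + 1)) (Fin (1 + 1)) E) := rfl
  set W₁ : Matrix (Fin (1 + 1)) (Fin (1 + 1)) (AdeleRing (𝓞 F) F) :=
    (((w : GL (Fin (1 + 1)) E) : Matrix (Fin (1 + 1)) (Fin (1 + 1)) E).map (QuadraticCoordinates.re Ψ)).map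
      (algebraMap F (AdeleRing (𝓞 F) F)) with hW₁
  set W₂ : Matrix (Fin (1 + 1)) (Fin (1 + 1)) (AdeleRing (𝓞 F) F) :=
    (((w : GL (Fin (1 + 1)) E) : Matrix (Fin (1 + 1)) (Fin (1 + 1)) E).map (QuadraticCoordinates.im Ψ)).map
      (algebraMap F (AdeleRing (𝓞 F) F)) with hW₂
  have hre : ((((rationalInr F E c N (1 + 1) JV JW w : rationalPair F E c N (1 + 1) JV JW) :
      GL (Fin N × Fin (1 + 1)) E) : Matrix (Fin N × Fin (1 + 1)) (Fin N × Fin (1 + 1)) E).map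
        (QuadraticCoordinates.re Ψ)).map (algebraMap F (AdeleRing (𝓞 F) F)) =
      (1 : Matrix (Fin N) (Fin N) (AdeleRing (𝓞 F) F)) ⊗ₖ W₁ := by
    rw [hcoe, one_kronecker_map, one_kronecker_map]
  have him : ((((rationalInr F E c N (1 + 1) JV JW w : rationalPair F E c N (1 + 1) JV JW) :
      GL (Fin N × Fin (1 + 1)) E) : Matrix (Fin N × Fin (1 + 1)) (Fin N × Fin (1 + 1)) E).map
        (QuadraticCoordinates.im Ψ)).map (algebraMap F (AdeleRing (𝓞 F) F)) =
      (1 : Matrix (Fin N) (Fin N) (AdeleRing (𝓞 F) F)) ⊗ₖ W₂ := by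
    rw [hcoe, one_kronecker_map, one_kronecker_map]
  rw [adelicPairToSymplectic_rationalPairToAdelic_apply, ← hΨ, hre, him] at h
  simp only [Matrix.mulVec_zero, smul_zero, add_zero] at h
  obtain ⟨h₁, h₂⟩ := h
  have hW₁S := rowSum_eq_of_one_kronecker_mulVec_one i h₁
  have hW₂S := rowSum_eq_of_one_kronecker_mulVec_one i h₂
  -- descend from `𝔸_F` to `F` (injectivity of `F → 𝔸_F`) and recombine `w = re w + im w · δ`
  have hinj := AdeleRing.algebraMap_injective (𝓞 F) F
  have hre' : QuadraticCoordinates.re Ψ (((w : GL (Fin (1 + 1)) E) : Matrix (Fin (1 + 1)) (Fin (1 + 1)) E) 0 0) +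
      QuadraticCoordinates.re Ψ (((w : GL (Fin (1 + 1)) E) : Matrix (Fin (1 + 1)) (Fin (1 + 1)) E) 0 1) =
      QuadraticCoordinates.re Ψ (((w : GL (Fin (1 + 1)) E) : Matrix (Fin (1 + 1)) (Fin (1 + 1)) E) 1 0) +
      QuadraticCoordinates.re Ψ (((w : GL (Fin (1 + 1)) E) : Matrix (Fin (1 + 1)) (Fin (1 + 1)) E) 1 1) := by
    apply hinj
    simpa [hW₁, Matrix.map_apply, map_add] using hW₁S
  have him' : QuadraticCoordinates.im Ψ (((w : GL (Fin (1 + 1)) E) : Matrix (Fin (1 + 1)) (Fin (1 + 1)) E) 0 0) +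
      QuadraticCoordinates.im Ψ (((w : GL (Fin (1 + 1)) E) : Matrix (Fin (1 + 1)) (Fin (1 + 1)) E) 0 1) =
      QuadraticCoordinates.im Ψ (((w : GL (Fin (1 + 1)) E) : Matrix (Fin (1 + 1)) (Fin (1 + 1)) E) 1 0) +
      QuadraticCoordinates.im Ψ (((w : GL (Fin (1 + 1)) E) : Matrix (Fin (1 + 1)) (Fin (1 + 1)) E) 1 1) := by
    apply hinj
    simpa [hW₂, Matrix.map_apply, map_add] using hW₂S
  rw [← map_add, ← map_add] at hre' him'
  rw [← hq.re_add_im ((((w : GL (Fin (1 + 1)) E) : Matrix (Fin (1 + 1)) (Fin (1 + 1)) E) 0 0) +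
        (((w : GL (Fin (1 + 1)) E) : Matrix (Fin (1 + 1)) (Fin (1 + 1)) E) 0 1)),
    ← hq.re_add_im ((((w : GL (Fin (1 + 1)) E) : Matrix (Fin (1 + 1)) (Fin (1 + 1)) E) 1 0) +
        (((w : GL (Fin (1 + 1)) E) : Matrix (Fin (1 + 1)) (Fin (1 + 1)) E) 1 1)), hre', him']

end Rational

end UnitaryGroup

end Literature.NumberTheory.Automorphic
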